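import Literature.IUT.HodgeTheaters.PuncturedEllipticArrowModelOrientedWitness
import Literature.IUT.HodgeTheaters.PuncturedEllipticCoveringsModLCuspLaws
import Literature.IUT.HodgeTheaters.PuncturedEllipticCoveringsArrowClaimsOfLawsIndex
import HarnessLib

/-!
# NV: the `Δ_ε`-level laws `ModLCuspLaws` HOLD at the finite §1 model `ArrowModel.datum`

[IUTchI] §1 pp. 37–38 [cite: Mochizuki2012, IUTchI §1 pp.37-38] (D-0012 claim key, status disputed).  PROOF-ONLY
NON-VACUITY companion of `PuncturedEllipticCoveringsModLCuspLaws.lean` (p446054; reviewer note (a): "file a small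
construction item proving it … so the binder is kernel-checked non-vacuous") over abc-iut-L5-t1 gen 3's finite
§1 model `ArrowModel.datum l h5 h6` (p431223: `Π_C = N ⋊ D_l`, `N = ℤ/l × (ℤ/l)^{ℤ/l}`, cusps `ℤ/l`,
`D_i = ⟨ĉ_i⟩`, `ĉ_i = (0, δ_{i+1} − δ_i)`, `ε⁰, ε′, ε″, 2ε = 0, 1, −1, 2`, `G_k = 1`).  Cell abc-iut, seat
abc-iut-L5-t1 (gen 5), abc-iut-L5-lead RULINGS #58 (10) GO («NV at ArrowModel.datum»).  No `def`, no instance.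

WHAT IS PROVED: `ArrowModel.modLCuspLaws (h5 : 5 ≤ l) (h6 : Nat.Coprime l 6) : (datum l h5 h6).ModLCuspLaws` — all
six laws at once, for every admissible `l` (symbolic): (L0) `Ker(Δ_X̲ ↠ Δ_X̲^{ab} ⊗ ℤ/l) = 1` has finite index
`|N|`; (L1) `D_i = ⟨ĉ_i⟩` is cyclic; (L2a) the image of `D_1 = ⟨ĉ_1⟩` in `N / ⨆_{i ∉ {0,±1}} D_i` has order `l`
(detected by the coordinate `ℓ(A, f) = f(0) − f(1)`, `ℓ(ĉ_1) = 1`); (L2c) `D_1 ∩ (D_{−1} · ⨆_{i ∉ {0,±1}} D_i) = 1`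
(detected by the coordinate `f ↦ f(1)`, which kills every `ĉ_i`, `i ≠ 1`, and is `−1` at `ĉ_1`); (L3) for
`ι̲ = (v, σ)`: `ι̲ (A, f) ι̲⁻¹ + (A, f) = (0, m ↦ f(m) − f(1 − m))`, a sum of cusp vectors (`Σ_i ĉ_i = 0`,
`sum_cvec_eq_zero`); (L4) `N` is abelian.  Together with `ArrowModel.cuspGalois` (p431223) and
`CuspGalois.arrowCoveringClaims_of_modLCuspLaws` this re-derives `ArrowModel.arrowCoveringClaims`, and shows the
hypothesis binder `ModLCuspLaws` of the «hA re-grounding» is CONSISTENT and NON-VACUOUS.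

HONEST FRAMING: a finite toy instance; nothing here asserts abc proved or refuted or takes a side on [IUTchIII]
Cor. 3.12; inhabited ≠ discharged at the genuine datum.
-/

namespace Literature.IUT.HodgeTheaters

namespace PuncturedEllipticData

namespace ArrowModel

open Literature.AnabelianGeometry.AbsoluteAnabelian DihedralGroup
open scoped Pointwise

variable {l : ℕ}

/-! ### Cusp vectors and the join of all cusp inertia groups -/

/-- `ĉ_i ∈ D_i`. [claim: Mochizuki2012, status: disputed] -/
theorem chat_mem_Dm (i : ZMod l) : chat l i ∈ Dm l i := by
  unfold Dm; exact Subgroup.mem_zpowers _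

/-- Every `ĉ_i` with `i ≠ 0` lies in `D_1 · D_{−1} · ⨆_{i ∉ {0,±1}} D_i`. [claim: Mochizuki2012, status: disputed] -/
theorem chat_mem_sup_of_ne_zero {i : ZMod l} (hi : i ≠ 0) : chat l i ∈ Dm l 1 ⊔ Dm l (-1) ⊔ EpsSup l := by
  by_cases h1 : i = 1
  · subst h1; exact Subgroup.mem_sup_left (Subgroup.mem_sup_left (chat_mem_Dm 1))
  by_cases h2 : i = -1
  · subst h2; exact Subgroup.mem_sup_left (Subgroup.mem_sup_right (chat_mem_Dm (-1)))
  refine Subgroup.mem_sup_right ?_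
  have h : Dm l i ≤ EpsSup l :=
    le_iSup (fun x : {x : ZMod l // x ≠ 0 ∧ x ≠ 1 ∧ x ≠ -1} => Dm l x.1) ⟨i, hi, h1, h2⟩
  exact h (chat_mem_Dm i)

/-- `ĉ_0` too (the cusp relation `Σ_i ĉ_i = 0`), hence ALL `ĉ_i` lie in `D_1 · D_{−1} · ⨆_{i ∉ {0,±1}} D_i`.
[claim: Mochizuki2012, status: disputed] -/
theorem chat_mem_sup [NeZero l] (i : ZMod l) : chat l i ∈ Dm l 1 ⊔ Dm l (-1) ⊔ EpsSup l := by
  by_cases hi : i = 0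
  · subst hi
    have hsum := sum_cvec_eq_zero l
    rw [← Finset.add_sum_erase _ _ (Finset.mem_univ (0 : ZMod l))] at hsum
    have e : cvec l 0 = -∑ x ∈ Finset.univ.erase (0 : ZMod l), cvec l x := eq_neg_of_add_eq_zero_left hsum
    unfold chat
    rw [e, inN_neg]
    refine Subgroup.inv_mem _ (inN_sum_mem l _ _ _ fun x hx => ?_)
    exact chat_mem_sup_of_ne_zero (Finset.ne_of_mem_erase hx)
  · exact chat_mem_sup_of_ne_zero hi

/-- `(0, δ_a − δ_b) = Σ` of cusp vectors lies in the join of all cusp inertia groups. [claim: Mochizuki2012, status: disputed] -/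
theorem inN_δ_sub_δ_mem_sup [NeZero l] (h3 : 3 ≤ l) (a b : ZMod l) :
    inN l (0, δ l a - δ l b) ∈ Dm l 1 ⊔ Dm l (-1) ⊔ EpsSup l := by
  -- via `δ_2`: `δ_a − δ_b = (δ_a − δ_2) − (δ_b − δ_2)`
  have key : ∀ m : ZMod l, inN l (0, δ l m - δ l 2) ∈ Dm l 1 ⊔ Dm l (-1) ⊔ EpsSup l := by
    intro m
    by_cases hm0 : m = 0
    · -- `δ_0 − δ_2 = −ĉ_0 − ĉ_1`
      subst hm0
      have e : ((0 : ZMod l), δ l 0 - δ l 2) = -cvec l 0 + -cvec l 1 := by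
        simp only [cvec, zero_add, Prod.neg_mk, neg_zero, neg_sub, Prod.mk_add_mk, add_zero]
        congr 1; rw [show (1 : ZMod l) + 1 = 2 by norm_num]; abel
      rw [e, inN_add, inN_neg, inN_neg]
      exact Subgroup.mul_mem _ (Subgroup.inv_mem _ (chat_mem_sup 0)) (Subgroup.inv_mem _ (chat_mem_sup 1))
    by_cases hm1 : m = 1
    · -- `δ_1 − δ_2 = −ĉ_1`
      subst hm1
      have e : ((0 : ZMod l), δ l 1 - δ l 2) = -cvec l 1 := by
        simp only [cvec, Prod.neg_mk, neg_zero, neg_sub]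
        rw [show (1 : ZMod l) + 1 = 2 by norm_num]
      rw [e, inN_neg]
      exact Subgroup.inv_mem _ (chat_mem_sup 1)
    · exact Subgroup.mem_sup_right (inN_δ_sub_δ_two_mem_EpsSup' l h3 hm0 hm1)
  have e : ((0 : ZMod l), δ l a - δ l b) = (0, δ l a - δ l 2) + -(0, δ l b - δ l 2) := by
    simp only [Prod.neg_mk, neg_zero, neg_sub, Prod.mk_add_mk, add_zero]; congr 1; abel
  rw [e, inN_add, inN_neg]
  exact Subgroup.mul_mem _ (key a) (Subgroup.inv_mem _ (key b))

/-! ### The laws, at the level of the finite group `N ⋊ D_l` -/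

/-- (L2a) at the model: the image of `D_1 = ⟨ĉ_1⟩` in `N / ⨆_{i ∉ {0,±1}} D_i` has order `l` (coordinate `ℓ`).
[claim: Mochizuki2012, status: disputed] -/
theorem relIndex_EpsSup_Dm_one_sup [NeZero l] (h3 : 3 ≤ l) :
    (EpsSup l).relIndex (Dm l 1 ⊔ EpsSup l) = l := by
  have hA : Dm l 1 ⊔ EpsSup l ≤ Nhat l := sup_le (Dm_le_Nhat l 1) ((EpsSup_le_Khat l).trans (Khat_le_Nhat l))
  have hnorm : ((EpsSup l).subgroupOf (Dm l 1 ⊔ EpsSup l)).Normal :=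
    normal_subgroupOf_of_commutator_le le_sup_right
      (((Subgroup.commutator_mono hA hA).trans (le_of_eq (commutator_Nhat_eq_bot l))).trans bot_le)
  refine relIndex_eq_of_le_zpowers_sup le_sup_right hnorm (Subgroup.mem_sup_left (chat_mem_Dm 1))
    (by unfold Dm; exact le_rfl) ?_ ?_
  · unfold chat; rw [← inN_nsmul, l_nsmul_eq_zero, inN_zero]; exact Subgroup.one_mem _
  · intro d hd
    have hK := EpsSup_le_Khat l hd
    unfold chat at hK
    rw [← inN_nsmul, inN_mem_Khat_iff, map_nsmul, ell_cvec_one l h3, nsmul_eq_mul, mul_one] at hK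
    exact (ZMod.natCast_eq_zero_iff d l).mp hK

/-- (L2c) at the model: `D_1 ∩ (D_{−1} · ⨆_{i ∉ {0,±1}} D_i) ⊆ ⨆_{i ∉ {0,±1}} D_i` (indeed `= 1`), detected by
the coordinate `f ↦ f(1)` (it kills `ĉ_i` for `i ≠ 0, 1` and is `−1` at `ĉ_1`). [claim: Mochizuki2012, status: disputed] -/
theorem Dm_one_inf_sup_le (h5 : 5 ≤ l) : Dm l 1 ⊓ (Dm l (-1) ⊔ EpsSup l) ≤ EpsSup l := by
  haveI : NeZero l := ⟨by omega⟩
  obtain ⟨-, cm10, c1m1, -, c21, -⟩ := cusp_facts_of_five_le l h5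
  -- the subgroup `T = {(v, 1) : v.2 1 = 0}`
  let T : Subgroup (G l) :=
    { carrier := {g | g.right = 1 ∧ (Multiplicative.toAdd g.left).2 1 = 0}
      mul_mem' := by
        rintro g h ⟨hg1, hg2⟩ ⟨hh1, hh2⟩
        refine ⟨by rw [SemidirectProduct.mul_right, hg1, hh1, mul_one], ?_⟩
        rw [SemidirectProduct.mul_left, hg1, map_one, MulAut.one_apply, toAdd_mul, Prod.snd_add,
          Pi.add_apply, hg2, hh2, add_zero]
      one_mem' := ⟨rfl, by simp⟩
      inv_mem' := by
        rintro g ⟨hg1, hg2⟩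
        refine ⟨by rw [SemidirectProduct.inv_right, hg1, inv_one], ?_⟩
        rw [SemidirectProduct.inv_left, hg1, inv_one, map_one, MulAut.one_apply, toAdd_inv, Prod.snd_neg,
          Pi.neg_apply, hg2, neg_zero] }
  have hchatT : ∀ i : ZMod l, i ≠ 0 → i ≠ 1 → chat l i ∈ T := by
    intro i hi0 hi1
    refine ⟨rfl, ?_⟩
    change (Multiplicative.toAdd (Multiplicative.ofAdd (cvec l i))).2 1 = 0
    rw [toAdd_ofAdd]
    simp only [cvec, Pi.sub_apply, δ_apply]
    have h1 : ¬ ((1 : ZMod l) = i + 1) := fun h => hi0 (by simpa using h.symm)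
    have h2 : ¬ ((1 : ZMod l) = i) := fun h => hi1 h.symm
    rw [if_neg h1, if_neg h2, sub_zero]
  have hle : Dm l (-1) ⊔ EpsSup l ≤ T := by
    refine sup_le ?_ (iSup_le fun x => ?_)
    · unfold Dm; rw [Subgroup.zpowers_le]; exact hchatT (-1) cm10 (fun h => c1m1 h.symm)
    · unfold Dm; rw [Subgroup.zpowers_le]; exact hchatT x.1 x.2.1 x.2.2.1
  rintro g ⟨hg1, hg2⟩
  have hg1' : g ∈ Subgroup.zpowers (chat l 1) := hg1
  obtain ⟨k, rfl⟩ := Subgroup.mem_zpowers_iff.mp hg1'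
  obtain ⟨-, hk⟩ := hle hg2
  unfold chat at hk ⊢
  rw [← inN_zsmul] at hk ⊢
  change (Multiplicative.toAdd (Multiplicative.ofAdd (k • cvec l 1))).2 1 = 0 at hk
  rw [toAdd_ofAdd, Prod.smul_snd, Pi.smul_apply] at hk
  have h21 : ((cvec l 1).2 : ZMod l → ZMod l) 1 = -1 := by
    simp only [cvec, Pi.sub_apply, δ_apply, if_true]
    rw [if_neg (fun h => c21 (by rw [h]; norm_num)), zero_sub]
  rw [h21, smul_neg, neg_eq_zero, zsmul_eq_mul, mul_one] at hk
  have hk0 : k • cvec l 1 = 0 := by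
    rw [← Int.cast_smul_eq_zsmul (ZMod l) k (cvec l 1), hk, zero_smul]
  rw [hk0, inN_zero]
  exact Subgroup.one_mem _

/-- (L3) at the model: for `ι̲ = (u, σ) ∈ Π_C̲ ∖ N` and `(A, f) ∈ N`, `ι̲ (A,f) ι̲⁻¹ · (A,f) = (0, m ↦ f(m) − f(1−m))`
lies in the join of all cusp inertia groups ("`ι` acts on `Δ_E ⊗ ℤ/l` via `−1`"). [claim: Mochizuki2012, status: disputed] -/
theorem conj_mul_self_mem_sup (h5 : 5 ≤ l) {c : G l} (hc : c ∈ PiCbarm l) (hcX : c ∉ Nhat l) {v : G l}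
    (hv : v ∈ Nhat l) : c * v * c⁻¹ * v ∈ Dm l 1 ⊔ Dm l (-1) ⊔ EpsSup l := by
  haveI : NeZero l := ⟨by omega⟩
  have h3 : 3 ≤ l := by omega
  have hcr : c.right = sr 0 := by
    rcases (mem_PiCbarm_iff l c).mp hc with h | h
    · exact absurd ((mem_Nhat_iff l c).mpr h) hcX
    · exact h
  rw [eq_inN_of_right_eq_one l ((mem_Nhat_iff l v).mp hv), conj_inN, hcr, dact_sr, ← inN_add]
  set w := Multiplicative.toAdd v.left with hw
  -- `σ_0 w + w = Σ_m w.2 m • (0, δ_m − δ_{1−m})`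
  have e : refl l 0 w + w = ∑ m : ZMod l, (w.2 m) • ((0 : ZMod l), δ l m - δ l (1 - m)) := by
    ext n
    · simp only [refl_apply, sub_zero, Prod.fst_add, neg_add_cancel, Prod.fst_sum, Prod.smul_fst,
        smul_zero, Finset.sum_const_zero]
    · simp only [refl_apply, sub_zero, Prod.snd_add, Pi.add_apply, Prod.snd_sum, Finset.sum_apply,
        Prod.smul_snd, Pi.smul_apply, Pi.sub_apply, smul_eq_mul, δ_apply, mul_sub, mul_ite, mul_one,
        mul_zero, Finset.sum_sub_distrib]
      have hswap : ∀ m : ZMod l, (n = 1 - m) = (m = 1 - n) := fun m => by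
        apply propext; constructor <;> intro h <;> rw [h] <;> ring
      simp only [hswap, Finset.sum_ite_eq', Finset.sum_ite_eq, Finset.mem_univ, if_true]
      ring
  rw [e]
  refine inN_sum_mem l _ _ _ fun m _ => ?_
  rw [← ZMod.natCast_zmod_val (w.2 m), Nat.cast_smul_eq_nsmul, inN_nsmul]
  exact Subgroup.pow_mem _ (inN_δ_sub_δ_mem_sup h3 m (1 - m)) _

/-- (L0) at the model: `N` is finite, so `[N : 1] ≠ 0`. [claim: Mochizuki2012, status: disputed] -/
theorem relIndex_bot_Nhat_ne_zero [NeZero l] : (⊥ : Subgroup (G l)).relIndex (Nhat l) ≠ 0 := by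
  haveI : Finite (G l) := finite_G l
  haveI : Finite (Nhat l) := Finite.of_injective (fun x : Nhat l => (x : G l)) Subtype.val_injective
  rw [Subgroup.relIndex_bot_left]
  exact Nat.card_pos.ne'

/-- (L4) at the model: `N` is abelian. [claim: Mochizuki2012, status: disputed] -/
theorem conj_mul_inv_eq_one {g z : G l} (hg : g ∈ Nhat l) {x : ZMod l} (hz : z ∈ Dm l x) :
    g * z * g⁻¹ * z⁻¹ = 1 := by
  have h : g * z * g⁻¹ * z⁻¹ ∈ ⁅Nhat l, Nhat l⁆ := by
    rw [← commutatorElement_def]; exact Subgroup.commutator_mem_commutator hg (Dm_le_Nhat l x hz)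
  rw [commutator_Nhat_eq_bot] at h
  exact Subgroup.mem_bot.mp h

/-! ### The laws at the model datum -/

/-- **NV: `ModLCuspLaws` holds at the §1 model datum** (all six laws, every admissible `l`).
([IUTchI] §1 pp.37–38) [claim: Mochizuki2012, status: disputed] -/
theorem modLCuspLaws (h5 : 5 ≤ l) (h6 : Nat.Coprime l 6) : (datum l h5 h6).ModLCuspLaws := by
  haveI : NeZero l := ⟨by omega⟩
  have h3 : 3 ≤ l := by omega
  refine ⟨?_, ?_, ?_, ?_, ?_, ?_⟩
  · -- (L0) `modLKer = 1`, `Δ_X̲ = N` finite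
    rw [modLKer_eq_bot, deltaXbar_eq]
    exact relIndex_bot_Nhat_ne_zero
  · -- (L1) `I_x = D_x = ⟨ĉ_x⟩`
    intro x
    refine ⟨chat l x, by rw [inertia_eq]; exact chat_mem_Dm x, ?_⟩
    rw [inertia_eq]
    exact Subgroup.le_topologicalClosure (G := (datum l h5 h6).PiC) (Subgroup.zpowers (chat l x))
  · -- (L2a)
    change (datum l h5 h6).deltaEpsKer.relIndex ((datum l h5 h6).inertia 1 ⊔ (datum l h5 h6).deltaEpsKer) = l
    rw [deltaEpsKer_eq, inertia_eq]
    exact relIndex_EpsSup_Dm_one_sup h3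
  · -- (L2c)
    change (datum l h5 h6).inertia 1 ⊓ ((datum l h5 h6).inertia (-1) ⊔ (datum l h5 h6).deltaEpsKer) ≤
      (datum l h5 h6).deltaEpsKer
    rw [inertia_eq, inertia_eq, deltaEpsKer_eq]
    exact Dm_one_inf_sup_le h5
  · -- (L3)
    intro c hc hcX v hv
    change c ∈ (datum l h5 h6).DeltaCbar at hc
    change c ∉ (datum l h5 h6).DeltaXbar at hcX
    change v ∈ (datum l h5 h6).DeltaXbar at hv
    change c * v * c⁻¹ * v ∈ (datum l h5 h6).inertia 1 ⊔ (datum l h5 h6).inertia (-1) ⊔ (datum l h5 h6).deltaEpsKer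
    rw [deltaCbar_eq] at hc
    rw [deltaXbar_eq] at hcX hv
    rw [inertia_eq, inertia_eq, deltaEpsKer_eq]
    exact conj_mul_self_mem_sup h5 hc hcX hv
  · -- (L4)
    intro x g hg z hz
    change g ∈ (datum l h5 h6).PiXbar at hg
    change z ∈ (datum l h5 h6).inertia x at hz
    rw [piXbar_eq] at hg
    rw [inertia_eq] at hz
    rw [modLKer_eq_bot, Subgroup.mem_bot]
    exact conj_mul_inv_eq_one hg hz

/-- **Consequence (NV of the whole «hA re-grounding»)**: the printed §1 claims at the model re-derived from the
laws — `ArrowCoveringClaims (datum l h5 h6)` via `CuspGalois.arrowCoveringClaims_of_modLCuspLaws`'s inputs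
(cusp action p431223, the laws above, `ι̲ := σ ∈ Δ_C̲ ∖ Δ_X̲`); cf. the direct proof
`ArrowModel.arrowCoveringClaims`. [claim: Mochizuki2012, status: disputed] -/
theorem exists_iota (h5 : 5 ≤ l) (h6 : Nat.Coprime l 6) :
    ∃ c ∈ (datum l h5 h6).DeltaCbar, c ∉ (datum l h5 h6).DeltaXbar := by
  refine ⟨sigmaHat l, ?_, ?_⟩
  · change sigmaHat l ∈ (datum l h5 h6).DeltaCbar
    rw [deltaCbar_eq]; exact sigmaHat_mem_PiCbarm l
  · change sigmaHat l ∉ (datum l h5 h6).DeltaXbar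
    rw [deltaXbar_eq]; exact sigmaHat_not_mem_Nhat l

end ArrowModel

end PuncturedEllipticData

end Literature.IUT.HodgeTheaters
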